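import Mathlib
import HarnessLib
import Literature.MathematicalPhysics.StatisticalMechanics.LatticeSobolevLine

/-!
# Discrete Leibniz rule on the torus: translates, reflections, and geometric bounds for
# iterated differences of products (Adams–Buchholz–Kotecký–Müller, proof of Lemma 7.7 (i))

The trace bound of [ABKM19] Lemma 7.7 (i) ((7.73)–(7.78)) expands
`M_k(m_χ 𝒞_{k+1}(· − x₀))` by the product rule for discrete derivatives
("`∇_i(fg) = ∇_i f S_i g + S_i f ∇_i g`", (7.75)) and bounds every term by the derivative bounds of
the cutoff `χ` (`|∇^l χ| ≤ Θ L^{−lk}`, (7.73)) and of the kernel (`|∇^α 𝒞_{k+1}| ≤ C L^{−k(d−2+|α|)}`,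
(7.77)).  This file provides that calculus for `GradientFRD.iterDiff` on `(ℤ/M)^d`, in the form of
GEOMETRIC DERIVATIVE BOUNDS `|∇^β f| ≤ a·p^{|β|}` (all `|β| ≤ n`), which are stable under products
with the rate `p + q`:

* `shiftFn v f = f(· + v)`, `iterDiff_shiftFn` (differences commute with translations),
  `reflectFn c f = f(c − ·)`, `iterDiff_reflectFn` (`∇^γ[f(c − ·)](x) = (−1)^{|γ|}(∇^γ f)(c − x − γ)`);
* `iterDiff_zero_index` (`∇^0 = id`), `iterDiff_iterDiff` (`∇^γ∇^β = ∇^{γ+β}`),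
  `iterDiff_linear_family` (differences in one variable commute with a linear functional in a
  second variable), `fwdDiff_mul` (the one-step Leibniz rule with the shift on the second
  factor), `iterDiff_fwdDiff` (`∇^β∇_i = ∇^{β+e_i}`);
* **`abs_iterDiff_mul_le`** — if `|∇^β f| ≤ a p^{|β|}` and `|∇^γ g| ≤ b q^{|γ|}` for all orders
  `≤ n`, then `|∇^α(fg)| ≤ a b (p+q)^{|α|}` for `|α| ≤ n`;
* `abs_iterDiff_le_two_pow_mul` (`|∇^β f| ≤ 2^{|β|} sup|f|`).

Everything is proved; no named fact.

## References
* S. Adams, S. Buchholz, R. Kotecký, S. Müller, arXiv:1910.13564, Lemma 7.7 (i), (7.75)–(7.78)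
  [AdamsBuchholzKoteckyMuller2019].
-/

noncomputable section

namespace Literature.MathematicalPhysics.StatisticalMechanics.GradientRG

open Finset
open Literature.MathematicalPhysics.StatisticalMechanics.GradientFRD (iterDiff)

variable {d M : ℕ}

/-! ## Translates and reflections -/

/-- The translate `f(· + v)`. [cite: AdamsBuchholzKoteckyMuller2019, Lemma 7.7 (i) (7.75) (the shift S_i)] -/
def shiftFn (v : Fin d → ZMod M) (f : (Fin d → ZMod M) → ℝ) : (Fin d → ZMod M) → ℝ :=
  fun x => f (x + v)

/-- The reflected translate `f(c − ·)`. [cite: AdamsBuchholzKoteckyMuller2019, Lemma 7.7 (i) (7.74)] -/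
def reflectFn (c : Fin d → ZMod M) (f : (Fin d → ZMod M) → ℝ) : (Fin d → ZMod M) → ℝ :=
  fun x => f (c - x)

/-- `shiftFn` unfolds pointwise. [cite: AdamsBuchholzKoteckyMuller2019, Lemma 7.7 (i) (7.75)] -/
@[simp] theorem shiftFn_apply (v : Fin d → ZMod M) (f : (Fin d → ZMod M) → ℝ) (x : Fin d → ZMod M) :
    shiftFn v f x = f (x + v) := rfl

/-- `reflectFn` unfolds pointwise. [cite: AdamsBuchholzKoteckyMuller2019, Lemma 7.7 (i) (7.74)] -/
@[simp] theorem reflectFn_apply (c : Fin d → ZMod M) (f : (Fin d → ZMod M) → ℝ) (x : Fin d → ZMod M) :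
    reflectFn c f x = f (c - x) := rfl

/-- `∇_i` commutes with translations. [cite: AdamsBuchholzKoteckyMuller2019, Lemma 7.7 (i) (7.75)] -/
theorem fwdDiff_shiftFn (i : Fin d) (v : Fin d → ZMod M) (f : (Fin d → ZMod M) → ℝ) :
    GradientFRD.fwdDiff i (shiftFn v f) = shiftFn v (GradientFRD.fwdDiff i f) := by
  funext x
  simp only [GradientFRD.fwdDiff, shiftFn]
  rw [add_right_comm]

/-- `∇_i` of a reflection is minus the shifted reflection of `∇_i`.
[cite: AdamsBuchholzKoteckyMuller2019, Lemma 7.7 (i) (7.74)] -/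
theorem fwdDiff_reflectFn (i : Fin d) (c : Fin d → ZMod M) (f : (Fin d → ZMod M) → ℝ) :
    GradientFRD.fwdDiff i (reflectFn c f) = -reflectFn (c - Pi.single i 1) (GradientFRD.fwdDiff i f) := by
  funext x
  simp only [GradientFRD.fwdDiff, reflectFn, Pi.neg_apply]
  rw [show c - Pi.single i 1 - x + Pi.single i 1 = c - x by abel,
    show c - (x + Pi.single i 1) = c - Pi.single i 1 - x by abel]
  ring

/-- The vector of a multi-index on the torus. [cite: AdamsBuchholzKoteckyMuller2019, App. A.5] -/
def natVec (β : Fin d → ℕ) : Fin d → ZMod M := fun i => ((β i : ℕ) : ZMod M)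

/-- `natVec` is additive. [cite: AdamsBuchholzKoteckyMuller2019, App. A.5] -/
theorem natVec_add (β γ : Fin d → ℕ) : (natVec (β + γ) : Fin d → ZMod M) = natVec β + natVec γ := by
  funext i; simp [natVec]

/-- `natVec e_i = e_i`. [cite: AdamsBuchholzKoteckyMuller2019, App. A.5] -/
theorem natVec_single (i : Fin d) : (natVec (Pi.single i 1) : Fin d → ZMod M) = Pi.single i 1 := by
  funext j
  by_cases h : j = i
  · subst h; simp [natVec]
  · simp [natVec, Pi.single_eq_of_ne h]

/-- A fold of commuting-with-translation operations commutes with translation (plumbing). [folklore] -/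
private theorem foldr_shiftFn (α : Fin d → ℕ) (l : List (Fin d)) (v : Fin d → ZMod M)
    (f : (Fin d → ZMod M) → ℝ) :
    l.foldr (fun j g => (GradientFRD.fwdDiff j)^[α j] g) (shiftFn v f) =
      shiftFn v (l.foldr (fun j g => (GradientFRD.fwdDiff j)^[α j] g) f) := by
  induction l with
  | nil => rfl
  | cons j l ih =>
    simp only [List.foldr_cons]
    rw [ih]
    exact Function.Commute.iterate_left (fun g => fwdDiff_shiftFn j v g) (α j) _

/-- **`∇^α` commutes with translations**: `∇^α(f(· + v)) = (∇^α f)(· + v)`.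
[cite: AdamsBuchholzKoteckyMuller2019, Lemma 7.7 (i) (7.75)] -/
theorem iterDiff_shiftFn (α : Fin d → ℕ) (v : Fin d → ZMod M) (f : (Fin d → ZMod M) → ℝ) :
    iterDiff α (shiftFn v f) = shiftFn v (iterDiff α f) :=
  foldr_shiftFn α (List.finRange d) v f

/-- `∇_i^{[n]}` of a reflection. [cite: AdamsBuchholzKoteckyMuller2019, Lemma 7.7 (i) (7.74)] -/
theorem iterate_fwdDiff_reflectFn (i : Fin d) (n : ℕ) (c : Fin d → ZMod M) (f : (Fin d → ZMod M) → ℝ) :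
    (GradientFRD.fwdDiff i)^[n] (reflectFn c f) =
      (-1 : ℝ) ^ n • reflectFn (c - (n : ZMod M) • Pi.single i 1) ((GradientFRD.fwdDiff i)^[n] f) := by
  induction n generalizing c f with
  | zero => simp
  | succ n ih =>
    rw [Function.iterate_succ_apply, fwdDiff_reflectFn, ← neg_one_smul ℝ (reflectFn _ _),
      iterate_fwdDiff_smul, ih, smul_smul, Function.iterate_succ_apply, pow_succ]
    congr 1
    · ring
    · congr 1
      simp only [Nat.cast_succ, add_smul, one_smul]
      abel

/-- A fold of reflections (plumbing for `iterDiff_reflectFn`). [folklore] -/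
private theorem foldr_reflectFn (α : Fin d → ℕ) (l : List (Fin d)) (hl : l.Nodup) (c : Fin d → ZMod M)
    (f : (Fin d → ZMod M) → ℝ) :
    l.foldr (fun j g => (GradientFRD.fwdDiff j)^[α j] g) (reflectFn c f) =
      (-1 : ℝ) ^ (∑ j ∈ l.toFinset, α j) •
        reflectFn (c - ∑ j ∈ l.toFinset, (α j : ZMod M) • Pi.single j 1)
          (l.foldr (fun j g => (GradientFRD.fwdDiff j)^[α j] g) f) := by
  induction l generalizing c f with
  | nil => simp
  | cons j l ih =>
    rw [List.nodup_cons] at hl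
    have hj : j ∉ l.toFinset := fun h => hl.1 (List.mem_toFinset.1 h)
    rw [List.foldr_cons, List.foldr_cons, ih hl.2, List.toFinset_cons, Finset.sum_insert hj,
      Finset.sum_insert hj]
    rw [iterate_fwdDiff_smul, iterate_fwdDiff_reflectFn, smul_smul, ← pow_add, add_comm (α j)]
    congr 2
    abel

/-- **`∇^γ` of a reflection**: `∇^γ[f(c − ·)] = (−1)^{|γ|} (∇^γ f)(c − γ − ·)`.
[cite: AdamsBuchholzKoteckyMuller2019, Lemma 7.7 (i) (7.74)] -/
theorem iterDiff_reflectFn (γ : Fin d → ℕ) (c : Fin d → ZMod M) (f : (Fin d → ZMod M) → ℝ) :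
    iterDiff γ (reflectFn c f) = (-1 : ℝ) ^ (∑ j, γ j) • reflectFn (c - natVec γ) (iterDiff γ f) := by
  have h := foldr_reflectFn γ (List.finRange d) (List.nodup_finRange d) c f
  have hset : (List.finRange d).toFinset = Finset.univ := by ext; simp
  rw [hset] at h
  have hvec : ∑ j, (γ j : ZMod M) • (Pi.single j 1 : Fin d → ZMod M) = natVec γ := by
    funext i
    rw [Finset.sum_apply, Finset.sum_eq_single i (fun j _ hji => by simp [Pi.single_eq_of_ne (Ne.symm hji)])
      (fun h => (h (mem_univ i)).elim)]
    simp [natVec]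
  rw [hvec] at h
  exact h

/-! ## The Leibniz rule -/

/-- `∇^0 = id`. [cite: AdamsBuchholzKoteckyMuller2019, App. A.5] -/
@[simp] theorem iterDiff_zero_index (f : (Fin d → ZMod M) → ℝ) : iterDiff 0 f = f := by
  unfold iterDiff
  induction (List.finRange d) with
  | nil => rfl
  | cons j l ih => rw [List.foldr_cons, ih]; rfl

/-- **One-step Leibniz rule**: `∇_i(fg) = (∇_i f)·g(· + e_i) + f·∇_i g` ((7.75) with the shift on
the second factor). [cite: AdamsBuchholzKoteckyMuller2019, Lemma 7.7 (i) (7.75)] -/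
theorem fwdDiff_mul (i : Fin d) (f g : (Fin d → ZMod M) → ℝ) :
    GradientFRD.fwdDiff i (f * g) = GradientFRD.fwdDiff i f * shiftFn (Pi.single i 1) g + f * GradientFRD.fwdDiff i g := by
  funext x
  simp only [GradientFRD.fwdDiff, shiftFn, Pi.mul_apply, Pi.add_apply]
  ring

/-- `∇^β ∇_i = ∇^{β + e_i}` (the order-raising step of the induction).
[cite: AdamsBuchholzKoteckyMuller2019, App. A.5] -/
theorem iterDiff_fwdDiff (β : Fin d → ℕ) (i : Fin d) (f : (Fin d → ZMod M) → ℝ) :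
    iterDiff β (GradientFRD.fwdDiff i f) = iterDiff (β + Pi.single i 1) f := by
  rw [iterDiff_add_single, fwdDiff_iterDiff]

/-- A multi-index of positive order has a positive component, and splits off a unit index.
[cite: AdamsBuchholzKoteckyMuller2019, App. A.5] -/
theorem exists_eq_add_single {α : Fin d → ℕ} {n : ℕ} (h : ∑ i, α i = n + 1) :
    ∃ (i : Fin d) (α' : Fin d → ℕ), α = α' + Pi.single i 1 ∧ ∑ i, α' i = n := by
  have hne : ∃ i, 0 < α i := by
    by_contra hcon
    push Not at hcon
    have : ∑ i, α i = 0 := Finset.sum_eq_zero fun i _ => Nat.le_zero.1 (hcon i)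
    omega
  obtain ⟨i, hi⟩ := hne
  refine ⟨i, α - (Pi.single i 1 : Fin d → ℕ), ?_, ?_⟩
  · funext j
    by_cases hj : j = i
    · subst hj; simp; omega
    · simp [Pi.single_eq_of_ne hj]
  · have hsplit : ∑ j, α j = ∑ j, (α - (Pi.single i 1 : Fin d → ℕ)) j + ∑ j, (Pi.single i 1 : Fin d → ℕ) j := by
      rw [← Finset.sum_add_distrib]
      refine Finset.sum_congr rfl fun j _ => ?_
      by_cases hj : j = i
      · subst hj; simp; omega
      · simp [Pi.single_eq_of_ne hj]
    rw [Finset.sum_pi_single'] at hsplit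
    simp only [mem_univ, if_true] at hsplit
    omega

/-- **`∇^γ ∇^β = ∇^{γ+β}`.** [cite: AdamsBuchholzKoteckyMuller2019, App. A.5] -/
theorem iterDiff_iterDiff (γ β : Fin d → ℕ) (f : (Fin d → ZMod M) → ℝ) :
    iterDiff γ (iterDiff β f) = iterDiff (γ + β) f := by
  have key : ∀ n : ℕ, ∀ γ : Fin d → ℕ, ∑ i, γ i = n →
      iterDiff γ (iterDiff β f) = iterDiff (γ + β) f := by
    intro n
    induction n with
    | zero =>
      intro γ hγ
      have hγ0 : γ = 0 := funext fun i => by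
        have := Finset.single_le_sum (f := γ) (fun j _ => Nat.zero_le _) (mem_univ i)
        rw [Pi.zero_apply]; omega
      subst hγ0; simp
    | succ n ih =>
      intro γ hγ
      obtain ⟨i, γ', rfl, hγ'⟩ := exists_eq_add_single hγ
      rw [iterDiff_add_single, ih γ' hγ', ← iterDiff_add_single, add_right_comm]
  exact key _ γ rfl

/-- One difference commutes with a linear functional applied in a second variable (plumbing for
`iterDiff_linear_family`). [folklore] -/
private theorem iterate_fwdDiff_linear_family (Z : ((Fin d → ZMod M) → ℝ) →ₗ[ℝ] ℝ) (j : Fin d)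
    (n : ℕ) : ∀ H : (Fin d → ZMod M) → (Fin d → ZMod M) → ℝ,
      (GradientFRD.fwdDiff j)^[n] (fun y => Z (H y)) =
        fun y => Z (fun z => (GradientFRD.fwdDiff j)^[n] (fun y' => H y' z) y) := by
  induction n with
  | zero => intro H; rfl
  | succ n ih =>
    intro H
    rw [Function.iterate_succ_apply, show GradientFRD.fwdDiff j (fun y => Z (H y)) =
      fun y => Z (fun z => GradientFRD.fwdDiff j (fun y' => H y' z) y) from ?_, ih]
    · rfl
    · funext y
      simp only [GradientFRD.fwdDiff]
      rw [← map_sub]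
      rfl

/-- **Differences in one variable commute with a linear functional in the other**: for a linear
`Z` and a two-variable `H`, `∇^β_y Z(H(y,·)) = Z(z ↦ ∇^β_y H(y,z))` (used to differentiate
`y ↦ [∇^α_z(χ(z)𝒞(z − y))](x)` in the trace bound). [cite: AdamsBuchholzKoteckyMuller2019, Lemma 7.7 (i) (7.74)] -/
theorem iterDiff_linear_family (Z : ((Fin d → ZMod M) → ℝ) →ₗ[ℝ] ℝ)
    (H : (Fin d → ZMod M) → (Fin d → ZMod M) → ℝ) (β : Fin d → ℕ) :
    iterDiff β (fun y => Z (H y)) = fun y => Z (fun z => iterDiff β (fun y' => H y' z) y) := by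
  have key : ∀ (l : List (Fin d)) (H : (Fin d → ZMod M) → (Fin d → ZMod M) → ℝ),
      l.foldr (fun j g => (GradientFRD.fwdDiff j)^[β j] g) (fun y => Z (H y)) =
        fun y => Z (fun z => l.foldr (fun j g => (GradientFRD.fwdDiff j)^[β j] g) (fun y' => H y' z) y) := by
    intro l
    induction l with
    | nil => intro H; rfl
    | cons j l ih =>
      intro H
      rw [List.foldr_cons, ih, iterate_fwdDiff_linear_family]
      rfl
  exact key (List.finRange d) H

/-- `|β + e_i| = |β| + 1`. [cite: AdamsBuchholzKoteckyMuller2019, App. A.5] -/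
theorem sum_add_single (β : Fin d → ℕ) (i : Fin d) :
    ∑ j, (β + (Pi.single i 1 : Fin d → ℕ)) j = ∑ j, β j + 1 := by
  simp only [Pi.add_apply, Finset.sum_add_distrib, Finset.sum_pi_single', mem_univ, if_true]

/-- **Geometric derivative bounds are stable under products** ([ABKM19] (7.76)–(7.78): every term
of the Leibniz expansion carries `|β|` derivatives on one factor and `|α| − |β|` on the other): if
`|∇^β f| ≤ a p^{|β|}` and `|∇^γ g| ≤ b q^{|γ|}` pointwise for all `|β|, |γ| ≤ n`, then
`|∇^α (fg)| ≤ a b (p+q)^{|α|}` for `|α| ≤ n`. [cite: AdamsBuchholzKoteckyMuller2019, Lemma 7.7 (i) (7.76)] -/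
theorem abs_iterDiff_mul_le {p q : ℝ} :
    ∀ (n : ℕ) (a b : ℝ) (f g : (Fin d → ZMod M) → ℝ),
      (∀ β : Fin d → ℕ, ∑ i, β i ≤ n → ∀ y, |iterDiff β f y| ≤ a * p ^ (∑ i, β i)) →
      (∀ γ : Fin d → ℕ, ∑ i, γ i ≤ n → ∀ y, |iterDiff γ g y| ≤ b * q ^ (∑ i, γ i)) →
      ∀ α : Fin d → ℕ, ∑ i, α i ≤ n → ∀ x, |iterDiff α (f * g) x| ≤ a * b * (p + q) ^ (∑ i, α i) := by
  intro n
  induction n with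
  | zero =>
    intro a b f g hf hg α hα x
    have hα0 : α = 0 := funext fun i => by
      have := Finset.single_le_sum (f := α) (fun j _ => Nat.zero_le _) (mem_univ i)
      rw [Pi.zero_apply]; omega
    subst hα0
    have h1 := hf 0 (by simp) x
    have h2 := hg 0 (by simp) x
    simp only [Pi.zero_apply, Finset.sum_const_zero, pow_zero, mul_one, iterDiff_zero_index] at h1 h2 ⊢
    rw [Pi.mul_apply, abs_mul]
    exact mul_le_mul h1 h2 (abs_nonneg _) ((abs_nonneg _).trans h1)
  | succ n ih =>
    intro a b f g hf hg α hα x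
    by_cases hlt : ∑ i, α i ≤ n
    · exact ih a b f g (fun β hβ => hf β (by omega)) (fun γ hγ => hg γ (by omega)) α hlt x
    have hαn : ∑ i, α i = n + 1 := by omega
    obtain ⟨i, α', rfl, hα'⟩ := exists_eq_add_single hαn
    -- `∇^{α'+e_i}(fg) = ∇^{α'}((∇_i f)(g∘shift)) + ∇^{α'}(f ∇_i g)`
    rw [← iterDiff_fwdDiff, fwdDiff_mul, iterDiff_add, Pi.add_apply, hαn]
    have ha : 0 ≤ a := le_trans (abs_nonneg _) (by simpa using hf 0 (by simp) x)
    have hb : 0 ≤ b := le_trans (abs_nonneg _) (by simpa using hg 0 (by simp) x)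
    -- first term: `(∇_i f, g(·+e_i))` with constants `(a p, b)`
    have h1 : |iterDiff α' (GradientFRD.fwdDiff i f * shiftFn (Pi.single i 1) g) x| ≤ a * p * b * (p + q) ^ n := by
      refine ih (a * p) b _ _ (fun β hβ y => ?_) (fun γ hγ y => ?_) α' hα'.le x |>.trans (by rw [hα'])
      · rw [iterDiff_fwdDiff]
        refine (hf _ (by rw [sum_add_single]; omega) y).trans ?_
        rw [sum_add_single, pow_succ]; ring_nf; exact le_rfl
      · rw [iterDiff_shiftFn, shiftFn_apply]
        exact hg γ (by omega) _
    -- second term: `(f, ∇_i g)` with constants `(a, b q)`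
    have h2 : |iterDiff α' (f * GradientFRD.fwdDiff i g) x| ≤ a * (b * q) * (p + q) ^ n := by
      refine ih a (b * q) _ _ (fun β hβ y => hf β (by omega) y) (fun γ hγ y => ?_) α' hα'.le x |>.trans
        (by rw [hα'])
      rw [iterDiff_fwdDiff]
      refine (hg _ (by rw [sum_add_single]; omega) y).trans ?_
      rw [sum_add_single, pow_succ]; ring_nf; exact le_rfl
    calc |iterDiff α' (GradientFRD.fwdDiff i f * shiftFn (Pi.single i 1) g) x + iterDiff α' (f * GradientFRD.fwdDiff i g) x|
        ≤ a * p * b * (p + q) ^ n + a * (b * q) * (p + q) ^ n := (abs_add_le _ _).trans (add_le_add h1 h2)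
      _ = a * b * (p + q) ^ (n + 1) := by ring

/-- **Crude bound**: `|∇^β f| ≤ 2^{|β|}·c` whenever `|f| ≤ c` (each difference at most doubles the
sup). [cite: AdamsBuchholzKoteckyMuller2019, Lemma 7.7 (i) (7.76)] -/
theorem abs_iterDiff_le_two_pow_mul {f : (Fin d → ZMod M) → ℝ} {c : ℝ} (hf : ∀ y, |f y| ≤ c) :
    ∀ (β : Fin d → ℕ) (y : Fin d → ZMod M), |iterDiff β f y| ≤ c * 2 ^ (∑ i, β i) := by
  -- `f = f · 1` with the constant function `1`, whose differences vanish
  intro β y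
  have h1 : ∀ n : ℕ, ∀ (γ : Fin d → ℕ), ∑ i, γ i ≤ n → ∀ z, |iterDiff γ f z| ≤ c * 2 ^ (∑ i, γ i) := by
    intro n
    induction n with
    | zero =>
      intro γ hγ z
      have hγ0 : γ = 0 := funext fun i => by
        have := Finset.single_le_sum (f := γ) (fun j _ => Nat.zero_le _) (mem_univ i)
        rw [Pi.zero_apply]; omega
      subst hγ0; simpa using hf z
    | succ n ih =>
      intro γ hγ z
      by_cases hlt : ∑ i, γ i ≤ n
      · exact ih γ hlt z
      have hγn : ∑ i, γ i = n + 1 := by omega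
      obtain ⟨i, γ', rfl, hγ'⟩ := exists_eq_add_single hγn
      rw [iterDiff_add_single, hγn]
      simp only [GradientFRD.fwdDiff]
      have ha := ih γ' hγ'.le (z + Pi.single i 1)
      have hb := ih γ' hγ'.le z
      rw [hγ'] at ha hb
      calc |iterDiff γ' f (z + Pi.single i 1) - iterDiff γ' f z| ≤ c * 2 ^ n + c * 2 ^ n :=
            (abs_sub _ _).trans (add_le_add ha hb)
        _ = c * 2 ^ (n + 1) := by ring
  exact h1 _ β le_rfl y

end Literature.MathematicalPhysics.StatisticalMechanics.GradientRG

end
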